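import Summits.ABC.ABC.Theses.IsogenyGlueCongruence
import Literature.NumberTheory.EllipticCurves.PastenSpectralDegree
import Literature.NumberTheory.EllipticCurves.PastenSpectralDegreeProofs
import Literature.NumberTheory.EllipticCurves.PeriodRelationsProofs
import HarnessLib

/-!
# Crux A `DegreePrimesPolyBounded` (stmt-ABC-2045), line `Sketch` — stub `stub_spectral`

The stub `stub_spectral` of the line `Sketch` for the crux
`Summit.ABC.ABC.Theses.IsogenyGlueCongruence.DegreePrimesPolyBounded`: Pasten, *Shimura curves
and the abc conjecture* (2024), Thm. 5.5 (= Thm. 1.8, case `D = 1`): for a modular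
parametrisation datum `D` of minimal degree in the class of its newform at level `N`, the
modular degree divides the product of the congruence moduli `η_f(P)` over the minimal primes
`P ≠ 𝕀_f` of the anemic Hecke ring `𝕋_N` (the tree's `PastenShimura2024_thm_5_5`).

This is a theorem of the tree: `PastenShimura2024_thm_5_5_holds`
(`Literature/NumberTheory/EllipticCurves/PeriodRelationsProofs.lean`) discharges it through
Riemann's period relations for `X₀(N)` in Petersson form
(`PastenShimura2024_thm_5_5_of_periodRelations`, Pasten §5.6 in homological form), bypassing the
unproved named fact `modularDegree_dvd_congruenceNumber` (Agashe–Ribet–Stein 2012, Thm. 2.1) used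
by the older reduction `PastenShimura2024_thm_5_5_of_modularDegree_dvd_congruenceNumber`.
-/

-- `Summit.ABC.ABC` is the mandated summit-side namespace (CONVENTIONS §2); the duplicate is
-- deliberate.
set_option linter.dupNamespace false

open Literature.NumberTheory.EllipticCurves.ModularForms

namespace Summit.ABC.ABC.Theorems.DegreePrimesPolyBounded

/-- **Stub `stub_spectral`** (Pasten 2024, Thm. 5.5, classical case `D = 1`): the class-minimal
modular degree divides the product of the congruence moduli over the minimal primes `P ≠ 𝕀_f` of
`𝕋_N` — the tree's theorem `PastenShimura2024_thm_5_5_holds` (Riemann's period relations for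
`X₀(N)`, `PeriodRelationsProofs`). -/
theorem stub_spectral : PastenShimura2024_thm_5_5 :=
  PastenShimura2024_thm_5_5_holds

end Summit.ABC.ABC.Theorems.DegreePrimesPolyBounded
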